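import Mathlib
import Summits.MatrixMultiplication.MatrixMultiplication.Theorems.SnSubsetDichotomyPolynomialSlackKeptSplitBC
import Summits.MatrixMultiplication.MatrixMultiplication.Theorems.SnSubsetDichotomyPolynomialSlackPairHeavyMass
import Summits.MatrixMultiplication.MatrixMultiplication.Theorems.SnSubsetDichotomyPolynomialSlackPairSharpMass
import Summits.MatrixMultiplication.MatrixMultiplication.Theorems.SnSubsetDichotomyPolynomialSlackHubSharp
import Summits.MatrixMultiplication.MatrixMultiplication.Theorems.SnSubsetDichotomyPolynomialSlackStubSplit
import Literature.Combinatorics.Additive.TPPGroupAlgebra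

/-!
# At most one dense quotient: the SHARP volume bound

Crux `Summit.MatrixMultiplication.MatrixMultiplication.Theses.SnSubsetDichotomy.PolynomialSlack`
(item `stmt-MatrixMultiplication-8306`), level-one programme, lead c8 (the 5/8 step), line
transport-split-hull. The sharp form of `volume_le_of_split_BC` (file `…SplitBC`): for a parity-pure TPP
triple `S, T, U ⊆ S_n` (`n ≥ 40`) whose quotients `B = T⁻¹U` and `C = U⁻¹S` are NON-DENSE at scale `M`
(`K_B = n!/(|T||U|) ≥ 16M`, `K_C = n!/(|U||S|) ≥ 16M`), the kept level-one inequality (`kept_split_BC`),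
the heavy-mass bounds of the two profiles (`pair_heavy_mass`, total `≤ Λ`; `pair_heavy_mass_sharp`, total
`≤ 1 + δ₄` for the sparser one) and the SHARP hub bound `volume_le_of_hub_sharp` (general dyadic hub
lemma) give

  `|S||T||U| ≤ 10368·9600²·(1+log n)⁶·Λ²·log²(6n!/(|S||T|))·n·B`

for every bound `B` on the volumes of TPP triples of `S_{n-1}`, as soon as the explicit error
`δ = n!/(2N) + n!√(n!)/(2N√(n(n-1)/6)) + 3√(100(1+log n)L/M)·F/√(n-1)` (`F = n!√(n!)/N`) satisfies
`δ + δ₄ ≤ 1/(7776Λ²(1+log n)⁴)` (`volume_le_of_split_BC_sharp`): the loss is `n·polylog` instead of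
`Λ³/((n-1)θ_B²θ_C²)`.
-/

namespace Summit.MatrixMultiplication.MatrixMultiplication.Theorems.PolynomialSlack

open scoped BigOperators
open Literature.Combinatorics.Additive (TripleProductProperty)

-- `Summit.<Summit>.<Problem>` is the tree's mandated summit-side namespace (CONVENTIONS §2); for
-- this single-conjunct summit the two coincide, so each declaration silences `dupNamespace`.
set_option linter.dupNamespace false

set_option maxHeartbeats 1600000 in
/-- **At most one dense quotient: the sharp volume bound** (registered sub-goal `volume_le_of_split_BC_sharp`
of the 5/8 programme). For `n ≥ 40`, a parity-pure TPP triple of non-empty sets with `K_B, K_C ≥ 16M`,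
logarithms `log(4n·n!/|T||U|), log(4n·n!/|U||S|) ≤ L`, `200(1+log n)L ≤ Λ`, the sharp heavy-mass excess
`(Λ/θ_X)²(n-2)!/|pair| ≤ δ₄` for `X = B` or `X = C` (`θ_B = n!/(|T||U|·n·M)`, `θ_C = n!/(|U||S|·n·M)`), and
the smallness `δ + δ₄ ≤ 1/(7776Λ²(1+log n)⁴)` of the explicit level-one error `δ`:
`|S||T||U| ≤ 10368·9600²·(1+log n)⁶·Λ²·log²(6n!/(|S||T|))·n·B`. [folklore] -/
theorem volume_le_of_split_BC_sharp {n : ℕ} (hn : 40 ≤ n) (B : ℕ)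
    (hB : ∀ S' T' U' : Finset (Equiv.Perm (Fin (n - 1))), TripleProductProperty S' T' U' →
      S'.card * T'.card * U'.card ≤ B)
    {S T U : Finset (Equiv.Perm (Fin n))} (hTPP : TripleProductProperty S T U)
    (hS0 : S.Nonempty) (hT0 : T.Nonempty) (hU0 : U.Nonempty)
    (hS : ∀ s ∈ S, ∀ s' ∈ S, Equiv.Perm.sign s = Equiv.Perm.sign s')
    (hT : ∀ t ∈ T, ∀ t' ∈ T, Equiv.Perm.sign t = Equiv.Perm.sign t')
    (hU : ∀ u ∈ U, ∀ u' ∈ U, Equiv.Perm.sign u = Equiv.Perm.sign u')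
    (M L Λ δ₄ : ℝ) (hM : 1 ≤ M) (hL : 1 ≤ L) (hΛ : 200 * (1 + Real.log n) * L ≤ Λ) (hδ₄ : 0 ≤ δ₄)
    (hKB : 16 * M ≤ (n.factorial : ℝ) / (T.card * U.card : ℕ))
    (hKC : 16 * M ≤ (n.factorial : ℝ) / (U.card * S.card : ℕ))
    (hLB : Real.log (4 * n * n.factorial / (T.card * U.card : ℕ)) ≤ L)
    (hLC : Real.log (4 * n * n.factorial / (U.card * S.card : ℕ)) ≤ L)
    (hsharp : (Λ / ((n.factorial : ℝ) / ((T.card * U.card : ℕ) * n * M))) ^ 2 * (n - 2).factorial /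
        (T.card * U.card : ℕ) ≤ δ₄ ∨
      (Λ / ((n.factorial : ℝ) / ((U.card * S.card : ℕ) * n * M))) ^ 2 * (n - 2).factorial /
        (U.card * S.card : ℕ) ≤ δ₄)
    (hsmall : (n.factorial : ℝ) / (2 * (S.card * T.card * U.card : ℕ)) +
          (n.factorial : ℝ) * Real.sqrt (n.factorial : ℝ) /
            (2 * (S.card * T.card * U.card : ℕ) * Real.sqrt (((n * (n - 1) : ℕ) : ℝ) / 6)) +
          3 * Real.sqrt (100 * (1 + Real.log n) * L / M) *
            ((n.factorial : ℝ) * Real.sqrt (n.factorial : ℝ) / (S.card * T.card * U.card : ℕ)) /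
              Real.sqrt ((n : ℝ) - 1) + δ₄ ≤ 1 / (7776 * Λ ^ 2 * (1 + Real.log n) ^ 4)) :
    ((S.card * T.card * U.card : ℕ) : ℝ) ≤
      10368 * 9600 ^ 2 * (1 + Real.log n) ^ 6 * Λ ^ 2 *
        (Real.log (6 * n.factorial / (S.card * T.card : ℕ))) ^ 2 * n * B := by
  classical
  have hn1 : 1 ≤ n := by omega
  have hn2 : 2 ≤ n := by omega
  have hnR : (40 : ℝ) ≤ n := by exact_mod_cast hn
  have hn0 : (0 : ℝ) < n := by linarith
  have hM0 : 0 < M := by linarith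
  have hf0 : (0 : ℝ) < n.factorial := by exact_mod_cast n.factorial_pos
  have hβ0 : (0 : ℝ) < (T.card * U.card : ℕ) := by exact_mod_cast Nat.mul_pos hT0.card_pos hU0.card_pos
  have hγ0 : (0 : ℝ) < (U.card * S.card : ℕ) := by exact_mod_cast Nat.mul_pos hU0.card_pos hS0.card_pos
  have hN0 : (0 : ℝ) < (S.card * T.card * U.card : ℕ) := by
    exact_mod_cast Nat.mul_pos (Nat.mul_pos hS0.card_pos hT0.card_pos) hU0.card_pos
  -- the thresholds
  set θB : ℝ := (n.factorial : ℝ) / ((T.card * U.card : ℕ) * n * M) with hθB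
  set θC : ℝ := (n.factorial : ℝ) / ((U.card * S.card : ℕ) * n * M) with hθC
  have hθB16 : 16 / (n : ℝ) ≤ θB := by
    rw [hθB, div_le_div_iff₀ hn0 (by positivity)]
    rw [le_div_iff₀ hβ0] at hKB
    nlinarith
  have hθC16 : 16 / (n : ℝ) ≤ θC := by
    rw [hθC, div_le_div_iff₀ hn0 (by positivity)]
    rw [le_div_iff₀ hγ0] at hKC
    nlinarith
  have hθB0 : 0 < θB := lt_of_lt_of_le (by positivity) hθB16
  have hθC0 : 0 < θC := lt_of_lt_of_le (by positivity) hθC16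
  -- the profiles and the heavy parts
  set dA : Fin n → Fin n → ℝ := fun i j =>
    (((S ×ˢ T).filter fun st => st.2 j = st.1 i).card : ℝ) / (S.card * T.card : ℕ) with hdA
  set dB : Fin n → Fin n → ℝ := fun j k =>
    (((T ×ˢ U).filter fun tu => tu.2 k = tu.1 j).card : ℝ) / (T.card * U.card : ℕ) with hdB
  set dC : Fin n → Fin n → ℝ := fun k i =>
    (((U ×ˢ S).filter fun us => us.2 i = us.1 k).card : ℝ) / (U.card * S.card : ℕ) with hdC
  set pB : Fin n → Fin n → ℝ := fun j k => if θB ≤ dB j k then dB j k - 1 / n else 0 with hpB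
  set pC : Fin n → Fin n → ℝ := fun k i => if θC ≤ dC k i then dC k i - 1 / n else 0 with hpC
  -- (1) the kept inequality
  have hkept := kept_split_BC hn hTPP hS0 hT0 hU0 hS hT hU dA dB dC pB pC (fun _ _ => rfl)
    (fun _ _ => rfl) (fun _ _ => rfl) M L hM hL hKB hKC hLB hLC (fun _ _ => rfl) (fun _ _ => rfl)
  -- (2) the heavy masses
  have hG0 : 0 ≤ 1 + Real.log n := by
    have := Real.log_nonneg (show (1 : ℝ) ≤ n by linarith); linarith
  have hinjB := injOn_quot_second hTPP hS0
  have hinjC := injOn_quot_first hTPP.rotate.rotate hT0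
  have hmassB : ∑ j : Fin n, ∑ k : Fin n, (if θB ≤ dB j k then dB j k else 0) ≤ Λ := by
    have h := pair_heavy_mass hn1 T U hT0 hU0 hinjB dB (fun _ _ => rfl) θB hθB16
    refine h.trans (le_trans ?_ hΛ)
    have : Real.log (4 * n * n.factorial / (T.card * U.card : ℕ)) * (200 * (1 + Real.log n)) ≤
        L * (200 * (1 + Real.log n)) := mul_le_mul_of_nonneg_right hLB (by positivity)
    linarith
  have hmassC : ∑ k : Fin n, ∑ i : Fin n, (if θC ≤ dC k i then dC k i else 0) ≤ Λ := by
    have h := pair_heavy_mass hn1 U S hU0 hS0 hinjC dC (fun _ _ => rfl) θC hθC16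
    refine h.trans (le_trans ?_ hΛ)
    have : Real.log (4 * n * n.factorial / (U.card * S.card : ℕ)) * (200 * (1 + Real.log n)) ≤
        L * (200 * (1 + Real.log n)) := mul_le_mul_of_nonneg_right hLC (by positivity)
    linarith
  have hmassB0 : 0 ≤ ∑ j : Fin n, ∑ k : Fin n, (if θB ≤ dB j k then dB j k else 0) :=
    Finset.sum_nonneg fun j _ => Finset.sum_nonneg fun k _ => by
      split_ifs
      · simp only [hdB]; positivity
      · exact le_rfl
  have hmassC0 : 0 ≤ ∑ k : Fin n, ∑ i : Fin n, (if θC ≤ dC k i then dC k i else 0) :=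
    Finset.sum_nonneg fun k _ => Finset.sum_nonneg fun i _ => by
      split_ifs
      · simp only [hdC]; positivity
      · exact le_rfl
  -- (3) the sharp bound for the sparser quotient
  have hsharp' : ∑ j : Fin n, ∑ k : Fin n, (if θB ≤ dB j k then dB j k else 0) ≤ 1 + δ₄ ∨
      ∑ k : Fin n, ∑ i : Fin n, (if θC ≤ dC k i then dC k i else 0) ≤ 1 + δ₄ := by
    rcases hsharp with h | h
    · left
      have hs := pair_heavy_mass_sharp T U hT0 hU0 hinjB dB (fun _ _ => rfl) θB hθB0
      refine hs.trans ?_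
      have hmono : ((∑ j : Fin n, ∑ k : Fin n, (if θB ≤ dB j k then dB j k else 0)) / θB) ^ 2 *
          (n - 2).factorial / (T.card * U.card : ℕ) ≤
          (Λ / θB) ^ 2 * (n - 2).factorial / (T.card * U.card : ℕ) := by
        apply div_le_div_of_nonneg_right _ hβ0.le
        apply mul_le_mul_of_nonneg_right _ (Nat.cast_nonneg _)
        apply pow_le_pow_left₀ (div_nonneg hmassB0 hθB0.le)
        exact div_le_div_of_nonneg_right hmassB hθB0.le
      linarith
    · right
      have hs := pair_heavy_mass_sharp U S hU0 hS0 hinjC dC (fun _ _ => rfl) θC hθC0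
      refine hs.trans ?_
      have hmono : ((∑ k : Fin n, ∑ i : Fin n, (if θC ≤ dC k i then dC k i else 0)) / θC) ^ 2 *
          (n - 2).factorial / (U.card * S.card : ℕ) ≤
          (Λ / θC) ^ 2 * (n - 2).factorial / (U.card * S.card : ℕ) := by
        apply div_le_div_of_nonneg_right _ hγ0.le
        apply mul_le_mul_of_nonneg_right _ (Nat.cast_nonneg _)
        apply pow_le_pow_left₀ (div_nonneg hmassC0 hθC0.le)
        exact div_le_div_of_nonneg_right hmassC hθC0.le
      linarith
  -- (4) the hub bound
  have hΛ1 : 1 ≤ Λ := by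
    have hG1 : 1 ≤ 1 + Real.log n := by linarith [Real.log_nonneg (show (1 : ℝ) ≤ n by linarith)]
    have : (1 : ℝ) * 1 ≤ (1 + Real.log n) * L := mul_le_mul hG1 hL zero_le_one hG0
    linarith
  set δ : ℝ := (n.factorial : ℝ) / (2 * (S.card * T.card * U.card : ℕ)) +
      (n.factorial : ℝ) * Real.sqrt (n.factorial : ℝ) /
        (2 * (S.card * T.card * U.card : ℕ) * Real.sqrt (((n * (n - 1) : ℕ) : ℝ) / 6)) +
      3 * Real.sqrt (100 * (1 + Real.log n) * L / M) *
        ((n.factorial : ℝ) * Real.sqrt (n.factorial : ℝ) / (S.card * T.card * U.card : ℕ)) /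
          Real.sqrt ((n : ℝ) - 1) with hδ
  have hδ0 : 0 < δ := by rw [hδ]; positivity
  exact volume_le_of_hub_sharp hn2 B hB hTPP hS0 hT0 hU0 dA dB dC pB pC (fun _ _ => rfl) (fun _ _ => rfl)
    (fun _ _ => rfl) θB θC Λ δ δ₄ hθB16 hθC16 (fun _ _ => rfl) (fun _ _ => rfl) hΛ1 hδ0 hδ₄ hsmall
    hmassB hmassC hsharp' hkept

end Summit.MatrixMultiplication.MatrixMultiplication.Theorems.PolynomialSlack
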